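import Mathlib
import Summits.MatrixMultiplication.MatrixMultiplication.Theses.SemilatticeSTPP
import Summits.MatrixMultiplication.MatrixMultiplication.Theorems.SemilatticeSTPPThesisAbelianLift
import Summits.MatrixMultiplication.MatrixMultiplication.Theorems.SemilatticeSTPPThesisCapacityReadback
import Summits.MatrixMultiplication.MatrixMultiplication.Theorems.AutomaticSTPPDesignsAutomaticPackingThesisCyclicCalibration080

/-!
# Line `localCapacity` of crux `SemilatticeSTPP.Thesis` (stmt-MatrixMultiplication-5969):
# the ∃-bodies of the crux and of `stub_capacityDesign` hold at every `ε ≥ 2/5`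

Calibration of the open stub by the tree's best certified abelian STPP design.  Route
`AutomaticSTPPDesigns` PROVED (`AutomaticDesignBelowFourFifths_proof`, Coppersmith–Winograd's level-1 laser
design for `CW₆` run inside one cyclic group by digit-sum slicing) that some cyclic group `ℤ/N` carries an STPP
family beating its host at exponent `4/5`, hence at every `τ ≥ 4/5`
(`AutomaticPackingThesis.cyclicBeat_anyModulus_of_ge080`).  By the abelian lift of this line
(`thesisBodyAt_of_isSTPP`, landed p155785: an STPP family in a finite abelian group is a monoid-TPP family of the
same shapes in `Multiplicative H`) this is a witness of the ∃-body of `Thesis` at every `ε ≥ 2/5`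
(`(2 + 2/5)/3 = 4/5`), and by the one-coordinate read-back (`capacityBodyAt_of_thesisBodyAt`, p147938) a capacity
design in the sense of the registered stub `stub_capacityDesign` at the same exponents.

So the certified range of the stub's ∃-body improves from `{ε > 1} ∪ {19/22}` (p147938, p150571) to every
`ε ≥ 2/5`; the crux is the limit `ε → 0`.  For comparison: local strong USPs reach `ε ≈ 0.48` (CKSU 2005
Prop. 3.8 + Prop. 6.3, not formalised), and no abelian-group or Clifford-monoid host is known below `ε = 2/5`
other than through CW-type designs.

Mathlib + the three tree files above; sorry-free; no new definitions.
-/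

set_option linter.dupNamespace false
-- (single-conjunct summit: the namespace repeats `MatrixMultiplication`)

namespace Summit.MatrixMultiplication.MatrixMultiplication.Theorems.SemilatticeSTPPThesis

open Literature.Computability.AlgebraicComplexity
open Summit.MatrixMultiplication.MatrixMultiplication.Theorems.AutomaticPackingThesis
  (cyclicBeat_anyModulus_of_ge080)

/-- **The ∃-body of the crux `Thesis` holds at every `ε ≥ 2/5`.**  Witness: the multiplicative copy of a cyclic
group `ℤ/N` carrying the tree's sliced Coppersmith–Winograd STPP design (`cyclicBeat_anyModulus_of_ge080` at
`τ := (2+ε)/3 ≥ 4/5`), transported by `thesisBodyAt_of_isSTPP`. [cite: CoppersmithWinograd1990, §7] -/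
theorem thesisBodyAt_of_ge_twoFifths :
    ∀ ε : ℝ, (2 : ℝ) / 5 ≤ ε → ∃ (M : Type) (_ : CommMonoid M) (_ : Fintype M),
      (∀ x : M, ∃ y : M, x * y * x = x) ∧
      ∃ (p : ℕ) (a b c : Fin p → ℕ) (α : (Σ i, Fin (a i) × Fin (b i)) → M)
        (β : (Σ i, Fin (b i) × Fin (c i)) → M) (γ : (Σ i, Fin (a i) × Fin (c i)) → M),
        (∀ x y z, α x * β y = γ z ↔
          (z.1 = x.1 ∧ x.1 = y.1 ∧ (z.2.1 : ℕ) = x.2.1 ∧ (x.2.2 : ℕ) = y.2.1 ∧ (z.2.2 : ℕ) = y.2.2)) ∧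
        (Fintype.card M : ℝ) < ∑ i, ((a i * b i * c i : ℕ) : ℝ) ^ ((2 + ε) / 3) := by
  intro ε hε
  have hτ : (4 : ℝ) / 5 ≤ (2 + ε) / 3 := by linarith
  obtain ⟨N, n, hN, A, B, C, hS, hbeat⟩ := cyclicBeat_anyModulus_of_ge080 ((2 + ε) / 3) hτ
  haveI : NeZero N := ⟨by omega⟩
  have hcard : (Fintype.card (ZMod N) : ℝ) = N := by rw [ZMod.card]
  exact thesisBodyAt_of_isSTPP (ZMod N) n A B C hS ((2 + ε) / 3) (by rw [hcard]; exact hbeat)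

/-- **The ∃-body of the registered stub `stub_capacityDesign` holds at every `ε ≥ 2/5`** (one-coordinate
designs over the base `Multiplicative (ZMod N)` read back from `thesisBodyAt_of_ge_twoFifths` by
`capacityBodyAt_of_thesisBodyAt`). [cite: CoppersmithWinograd1990, §7] -/
theorem capacityDesignBody_of_ge_twoFifths :
    ∀ ε : ℝ, (2 : ℝ) / 5 ≤ ε → ∃ (C : Type) (_ : CommMonoid C) (_ : Fintype C),
      (∀ x : C, ∃ y : C, x * y * x = x) ∧
      ∃ (k : ℕ) (ag bg cg : Fin k → ℕ)
        (αg : (Σ σ : Fin k, Fin (ag σ) × Fin (bg σ)) → C)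
        (βg : (Σ σ : Fin k, Fin (bg σ) × Fin (cg σ)) → C)
        (γg : (Σ σ : Fin k, Fin (ag σ) × Fin (cg σ)) → C)
        (L n : ℕ) (row : Fin L → Fin n → Fin k),
        (∀ (σ : Fin k) (s s' : Fin (ag σ)) (t t' : Fin (bg σ)) (u u' : Fin (cg σ)),
            αg ⟨σ, (s, t)⟩ * βg ⟨σ, (t', u)⟩ = γg ⟨σ, (s', u')⟩ ↔ (s' = s ∧ t = t' ∧ u' = u)) ∧
        (∀ i j l : Fin L, (i ≠ j ∨ j ≠ l) → ∃ c : Fin n,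
            ∀ (s : Fin (ag (row i c))) (t : Fin (bg (row i c))) (t' : Fin (bg (row j c)))
              (u : Fin (cg (row j c))) (s' : Fin (ag (row l c))) (u' : Fin (cg (row l c))),
              αg ⟨row i c, (s, t)⟩ * βg ⟨row j c, (t', u)⟩ ≠ γg ⟨row l c, (s', u')⟩) ∧
        (Fintype.card C : ℝ) ^ n <
          ∑ i : Fin L, (((∏ c, ag (row i c)) * (∏ c, bg (row i c)) * (∏ c, cg (row i c)) : ℕ) : ℝ) ^
            ((2 + ε) / 3) := by
  intro ε hε
  exact capacityBodyAt_of_thesisBodyAt ((2 + ε) / 3) (thesisBodyAt_of_ge_twoFifths ε hε)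

end Summit.MatrixMultiplication.MatrixMultiplication.Theorems.SemilatticeSTPPThesis
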